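import Summits.MatrixMultiplication.OmegaCensus.STPPKernelListerOrderN55DP1

/-!
# ω-census (abelian STPP census): kernel lister — ORDER capstone at `n = 55` MODULO the 63 tree-law survivor pattern(s) (part 14 of 21: root computation over `selN55P14`)

HONEST FRAMING (pub-omega census; verbatim): lottery ticket; floor = certified bounds/negative ranges.
Census STRUCTURE (seat pub-omega-stpp-2 gen 31 (generator of stpp-2 gen 30), 2026-08-29), family (b2).  Nothing here is progress on `ω`.  CONDITIONAL THEOREM: for every
finite abelian group `H` of order `55`, IF none of the 63 size patterns of `deadN55` (`234_244`, `235_235`, `235_253`, `235_325`, `235_333`, `235_352`, `235_532`, `244_333`, `112_234_253`, `112_234_523`, `112_243_253`, `112_243_352`, `112_243_523`, `112_253_342`, `112_253_432`, `112_333_333`, `112_342_352`, `124_243_243`, `124_243_432`, `124_432_432`, `133_423_423`, `133_423_432`, `222_233_235`, `222_233_325`, `222_233_523`, `222_234_234`, `222_234_324`, `223_232_244`, `224_243_332`, `224_252_522`, `224_332_342`, `225_233_323`, `225_332_332`, `233_234_332`, `111_111_333_333`, `111_122_333_423`, `112_123_243_243`, `112_123_243_432`, `112_123_432_432`, `112_161_423_423`,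 `112_223_243_332`, `112_223_332_342`, `112_232_234_323`, `112_232_243_323`, `112_232_323_324`, `112_232_323_423`, `112_232_323_432`, `112_233_233_233`, `112_233_233_323`, `112_233_233_332`, `112_233_332_332`, `114_122_432_432`, `114_223_252_522`, `122_224_242_522`, `122_233_233_422`, `122_323_332_422`, `124_242_422_422`, `222_223_332_332`, `222_224_242_422`, `223_223_242_422`, `223_224_232_422`, `111_111_223_243_332`, `111_111_223_332_342`) is realisable in `H` as an STPP family
(CKSU Def. 5.1), THEN every STPP family of `H` has `Σ |Aᵢ||Bᵢ||Cᵢ| ≤ 55` (no beating family, no `ω < 3` via CKSU Thm. 5.5).  The dead list is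
EXACTLY the set of minimal beating size patterns (canonical classes, all block counts, all entries) that survive the seven tree laws of the kernel
lister at order `55` (single-block volume, representation count, N7, N16, N8 = Kneser over all divisors, N18, N12) — i.e. the residual census
obligation at order `55` is reduced to deciding these 63 explicit patterns per group (by search engines or future kernel kills).  Mechanism:
`KLister.volume_le_of_scan_list_dead` (`STPPKernelListerOrderKitD`) over the root computation with this dead list, split over 21 first-block
selection(s) (`decide +kernel`; python twin `gen_orderD.py`/`klister_lean.py`, 2425673 calls, canonical-equality dead test, fixpoint in 2 round(s)).
-/

open Finset

namespace Summit.MatrixMultiplication.OmegaCensus.KLister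

open Literature.Computability.AlgebraicComplexity


/-- First blocks of part 14 of the root computation at order `55`. [folklore] -/
def selN55P14 : List Shape := [(3, 2, 3)]

set_option maxRecDepth 32768 in
set_option maxHeartbeats 4000000 in
/-- Root computation of the kernel lister at order `55` with the dead list `deadN55`, first blocks in `selN55P14`: `true` (twin 126753 calls). [folklore] -/
theorem scan_N55P14 : scanFirstC 55 deadN55 (fun s => selN55P14.contains s) chunksN55 = true := by
  decide +kernel

end Summit.MatrixMultiplication.OmegaCensus.KLister
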